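import Summits.Ventures.GridStability.Models.StructurePreservingSlabWindow

/-!
# GridStability/Models/StructurePreservingSlabRankOne — the slab certificate for MV-3 with the
# RANK-ONE (Schur) level: per-line facts `s_e·P − C_eᵀC_e ⪰ 0` and the closed test `c·s_e ≤ γ_lo²`

LADDER-GRIDFUSION G2 «SP–Lur'e lane» / G3 register, seat gridfusion-model-2 (g6); lead RULING R-SP9-LEVEL
(2026-08-27T06:00:29Z): sos-2 measured on the SP9 canary class that the rank-one level certifies a region
×149 larger in level (×12 in radius) than the ε-level AT THE SAME certificate, for the price of `m` small
PSD facts; NE39SP and later slab rows use the rank-one route from the start. This file is the generic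
receptacle (companion of `StructurePreservingSlabWindow.lean`, whose ε-route stays as the zero-extra-facts
floor): `Params.tendsto_relState_of_slabCertificate_of_rankOne_window` and its printed-vocabulary twin
— lit-6's `SlabCertificate.lt_V_of_mem_frontier_slab` (p497347) with per-line `s_e > 0`,
`s_e·P − C_eᵀC_e ⪰ 0` and the closed rational test `c·s_e ≤ γ_lo²` (then `γ_lo < γ = 2·arctan u` gives
`c < γ²/s_e`), everything else as in the window file (sectors from the typed window, `a_e ≤ a₀(u)` exact,
`b_e ≥ 1`, initial test `|σ_e(0) − σ*_e| ≤ γ_lo`). THREE COLUMNS: MODELLED column only (typing); no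
certificate here; nothing says a grid is stable. MODELLED: absent effects = MODEL-VALIDITY MV-3.
-/

noncomputable section

open Finset Real Set Filter Matrix
open scoped Topology
open Literature.MathematicalPhysics.PowerSystems
open Literature.MathematicalPhysics.PowerSystems.LyapunovFunctionFamily

namespace Summit.Ventures.GridStability.Models.StructurePreserving.Params

variable {k g m : ℕ} {p : Params (k + 1)} {r : Fin (k + 1)} {gnode : Fin g → Fin (k + 1)}
  {src tgt : Fin m → Fin (k + 1)} {wt : Fin m → ℝ} {δs : Fin (k + 1) → ℝ}

/-- **The rank-one level from the closed test**: if `0 ≤ γ_lo < γ`, `s_e > 0` and `c·s_e ≤ γ_lo²` on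
every listed line, then `c < γ²/s_e`. [cite: VuTuritsyn2017, §4.3 eq. (V_min)] -/
theorem level_lt_of_rankOne_test {γ γlo c : ℝ} {s : Fin m → ℝ} (hγ0 : 0 ≤ γlo) (hlt : γlo < γ)
    (hs0 : ∀ e, 0 < s e) (hc : ∀ e, c * s e ≤ γlo ^ 2) (e : Fin m) : c < γ ^ 2 / s e := by
  rw [lt_div_iff₀ (hs0 e)]
  have hsq : γlo ^ 2 < γ ^ 2 := pow_lt_pow_left₀ hlt hγ0 two_ne_zero
  exact (hc e).trans_lt hsq

/-- **SLAB CERTIFICATE FOR MV-3 WITH THE RANK-ONE LEVEL, ALL SIDE CONDITIONS RATIONAL.** As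
`tendsto_relState_of_slabCertificate_of_window` (p500128) but the level comes from per-line facts
`s_e·P − C_eᵀC_e ⪰ 0`, `s_e > 0` and the closed test `c·s_e ≤ γ_lo²` (lit-6's
`SlabCertificate.lt_V_of_mem_frontier_slab`). Conclusion unchanged: every phase solution of `p.phaseField`
with `|σ_e(0) − σ*_e| ≤ γ_lo` and `V(relState(X 0)) ≤ c` keeps `|σ_e(t) − σ*_e| < 2·arctan u` and `V ≤ c`
for all `t ≥ 0`, and its relative state tends to `0`. CERTIFIED given `Λ` and the `s_e` facts; MODEL
MV-3; inner estimate (larger than the ε-level's at the same `Λ`).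
[cite: Pai1981, §2.16 Theorem [18] and §4.6–§4.7; VuTuritsyn2017, §4.3 Theorem 1 with eq. (V_min)] -/
theorem tendsto_relState_of_slabCertificate_of_rankOne_window (hp : p.WellFormed) (hr : r ∉ p.gen)
    (hginj : Function.Injective gnode) (hgen : ∀ v, v ∈ p.gen ↔ ∃ j, gnode j = v)
    (hb : p.b = symmetrize (edgeWeight src tgt wt)) (hP : ∀ v, p.pe δs v = p.P0 v)
    (Λ : SlabCertificate (p.relLurie r gnode src tgt wt δs))
    {τ : ℝ} (hτ1 : τ < 1) (hwin : ∀ e, |δs (src e) - δs (tgt e)| ≤ 2 * Real.arctan τ)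
    {u γlo : ℝ} (hu0 : 0 < u) (hu1 : u ≤ 1) (hγ0 : 0 ≤ γlo)
    (hγ : γlo ^ 2 * (1 + u ^ 2) ≤ 4 * u ^ 2)
    (ha : ∀ e, Λ.a e ≤ ((1 - τ ^ 2) * (1 - u ^ 2) - 4 * τ * u) / ((1 + τ ^ 2) * (1 + u ^ 2)))
    (hb1 : ∀ e, 1 ≤ Λ.b e)
    {s : Fin m → ℝ} (hs0 : ∀ e, 0 < s e)
    (hs : ∀ e, (s e • Λ.P - Matrix.vecMulVec ((p.relLurie r gnode src tgt wt δs).C e)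
      ((p.relLurie r gnode src tgt wt δs).C e)).PosSemidef)
    {c : ℝ} (hc : ∀ e, c * s e ≤ γlo ^ 2)
    {X : ℝ → (Fin (k + 1) → ℝ) × (Fin (k + 1) → ℝ)}
    (hX : ∀ T : ℝ, ∀ t ∈ Icc 0 T, HasDerivWithinAt X (p.phaseField (X t)) (Icc 0 T) t)
    (h0 : ∀ e, |((X 0).1 (src e) - (X 0).1 (tgt e)) - (δs (src e) - δs (tgt e))| ≤ γlo)
    (hVc : Λ.V (relState r gnode δs (X 0)) ≤ c) :
    (∀ t, 0 ≤ t →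
        (∀ e, |((X t).1 (src e) - (X t).1 (tgt e)) - (δs (src e) - δs (tgt e))|
          < 2 * Real.arctan u) ∧
        Λ.V (relState r gnode δs (X t)) ≤ c) ∧
      Tendsto (fun t => relState r gnode δs (X t)) atTop (𝓝 0) := by
  have hγpos : 0 ≤ 2 * Real.arctan u := Lyapunov.StructurePreserving.two_mul_arctan_nonneg hu0.le
  have hθγ : 2 * Real.arctan τ + 2 * Real.arctan u ≤ π := (two_arctan_add_lt_pi hτ1 hu1).le
  have ha' : ∀ e, Λ.a e ≤ Real.cos (2 * Real.arctan τ + 2 * Real.arctan u) := fun e => by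
    rw [cos_two_arctan_add]; exact ha e
  have hsec := relLurie_slab_sector_of_window (p := p) (r := r) (gnode := gnode) (src := src)
    (tgt := tgt) (wt := wt) (δs := δs) Λ hγpos hθγ hwin ha' hb1
  have hlt : γlo < 2 * Real.arctan u := lt_two_arctan_of_sq_le hu0 hγ0 hγ
  have hc' : ∀ e : Fin m, c < (2 * Real.arctan u) ^ 2 / s e :=
    level_lt_of_rankOne_test hγ0 hlt hs0 hc
  have hfr : ∀ x ∈ frontier ((p.relLurie r gnode src tgt wt δs).slab (fun _ => 2 * Real.arctan u)),
      c < Λ.V x := fun x hx => Λ.lt_V_of_mem_frontier_slab hsec hs0 hs hc' hx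
  have h0' : ∀ e, |((X 0).1 (src e) - (X 0).1 (tgt e)) - (δs (src e) - δs (tgt e))|
      < 2 * Real.arctan u := fun e => (h0 e).trans_lt hlt
  exact tendsto_relState_of_slabCertificate hp hr hginj hgen hb hP Λ hsec hfr hX h0' hVc

/-- **The same for the structure-preserving model AS PRINTED** (`p.IsSolution δ`, any `P⁰`, synchronous
equilibrium `δ*` with frequency `ω₀`). [cite: Pai1981, §2.16 Theorem [18] and §4.7; VuTuritsyn2017, §4.3 Theorem 1; Padiyar2013, §3.2 eq (3.2)] -/
theorem tendsto_of_isSolution_of_slabCertificate_of_rankOne_window (hp : p.WellFormed) (hr : r ∉ p.gen)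
    (hginj : Function.Injective gnode) (hgen : ∀ v, v ∈ p.gen ↔ ∃ j, gnode j = v)
    (hb : p.b = symmetrize (edgeWeight src tgt wt)) (hδeq : p.IsSyncEquilibrium δs)
    (Λ : SlabCertificate (p.relLurie r gnode src tgt wt δs))
    {τ : ℝ} (hτ1 : τ < 1) (hwin : ∀ e, |δs (src e) - δs (tgt e)| ≤ 2 * Real.arctan τ)
    {u γlo : ℝ} (hu0 : 0 < u) (hu1 : u ≤ 1) (hγ0 : 0 ≤ γlo)
    (hγ : γlo ^ 2 * (1 + u ^ 2) ≤ 4 * u ^ 2)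
    (ha : ∀ e, Λ.a e ≤ ((1 - τ ^ 2) * (1 - u ^ 2) - 4 * τ * u) / ((1 + τ ^ 2) * (1 + u ^ 2)))
    (hb1 : ∀ e, 1 ≤ Λ.b e)
    {s : Fin m → ℝ} (hs0 : ∀ e, 0 < s e)
    (hs : ∀ e, (s e • Λ.P - Matrix.vecMulVec ((p.relLurie r gnode src tgt wt δs).C e)
      ((p.relLurie r gnode src tgt wt δs).C e)).PosSemidef)
    {c : ℝ} (hc : ∀ e, c * s e ≤ γlo ^ 2)
    {δ : ℝ → Fin (k + 1) → ℝ} (hδ : p.IsSolution δ)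
    (h0 : ∀ e, |(δ 0 (src e) - δ 0 (tgt e)) - (δs (src e) - δs (tgt e))| ≤ γlo)
    (hVc : Λ.V (relState r gnode δs (δ 0, fun v => deriv (fun u => δ u v) 0 - p.syncFreq)) ≤ c) :
    (∀ t, 0 ≤ t → ∀ e, |(δ t (src e) - δ t (tgt e)) - (δs (src e) - δs (tgt e))|
        < 2 * Real.arctan u) ∧
      (∀ v w, Tendsto (fun t => δ t v - δ t w) atTop (𝓝 (δs v - δs w))) ∧
      ∀ v ∈ p.gen, Tendsto (fun t => deriv (fun u => δ u v) t) atTop (𝓝 p.syncFreq) := by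
  have hγpos : 0 ≤ 2 * Real.arctan u := Lyapunov.StructurePreserving.two_mul_arctan_nonneg hu0.le
  have hθγ : 2 * Real.arctan τ + 2 * Real.arctan u ≤ π := (two_arctan_add_lt_pi hτ1 hu1).le
  have ha' : ∀ e, Λ.a e ≤ Real.cos (2 * Real.arctan τ + 2 * Real.arctan u) := fun e => by
    rw [cos_two_arctan_add]; exact ha e
  have hsec := relLurie_slab_sector_of_window (p := p) (r := r) (gnode := gnode) (src := src)
    (tgt := tgt) (wt := wt) (δs := δs) Λ hγpos hθγ hwin ha' hb1
  have hlt : γlo < 2 * Real.arctan u := lt_two_arctan_of_sq_le hu0 hγ0 hγ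
  have hc' : ∀ e : Fin m, c < (2 * Real.arctan u) ^ 2 / s e :=
    level_lt_of_rankOne_test hγ0 hlt hs0 hc
  have hfr : ∀ x ∈ frontier ((p.relLurie r gnode src tgt wt δs).slab (fun _ => 2 * Real.arctan u)),
      c < Λ.V x := fun x hx => Λ.lt_V_of_mem_frontier_slab hsec hs0 hs hc' hx
  have h0' : ∀ e, |(δ 0 (src e) - δ 0 (tgt e)) - (δs (src e) - δs (tgt e))|
      < 2 * Real.arctan u := fun e => (h0 e).trans_lt hlt
  exact tendsto_of_isSolution_of_slabCertificate hp hr hginj hgen hb hδeq Λ hsec hfr hδ h0' hVc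

end Summit.Ventures.GridStability.Models.StructurePreserving.Params

end
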